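import Literature.NumberTheory.EllipticCurves.Kato2004.KummerCupLevelClassConj
import Literature.NumberTheory.GaloisRepresentations.ContinuousCorestrictionKernelTest
import HarnessLib

/-!
# The coboundary test for corestricted Kummer–cup classes:
# `cor_{H→U}(κ_H(β) ∪_ζ e) = 0` forces the TWISTED NORM `∏ₓ (s(x)β)^{bₓcₓ}` to be fixed by `H`

Curve-generic, prime-generic (any field `K`, any Weierstrass curve `E`, level `N = p` prime).  Setting: `H ⊴ Γ_K` open of
finite index in `U ≥ H`, representatives `s` of `U/H`; a primitive `p`-th root `ζ` and a point `e ∈ E[p]`, `e ≠ 0`, both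
fixed by `H`; an additive `U`-equivariant `g : E[p] → E[p]` with `g e = 0`, `(im g)^U = 0` and `H` acting trivially on
`ker g` (in the application: `g = g₁ = φ|E[7]` with `φ² = [−7]`, `e ∈ W[𝔭] = ker g₁ = im g₁`, `W[𝔭]^{U} = 0` because the
character `ω⁻¹χ_D` of `W[𝔭]` is non-trivial on `U = Gal(K̄/Kℚ_n)`, and `H = Gal(K̄/F′_n)` fixes `W[𝔭]`); integers
`aₓ, bₓ, cₓ` with `s(x) ζ = ζ^{aₓ}`, `bₓaₓ ≡ 1 (p)`, `s(x) e = cₓ e` (the cyclotomic character and the character of the line).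
★ `forall_smul_eq_of_coresLe_kummerCupLevelClass_eq_zero`: if `cor_{H→U}(κ_H(β) ∪_ζ e) = 0` in `H¹(U, E[p])` then
`β″ := ∏ₓ (s(x)β)^{bₓcₓ}` satisfies `σ β″ = β″` for all `σ ∈ H` — i.e. `β″ ∈ (K̄^H)^×` and `b″ := β″^p = ∏ₓ (s(x) b)^{bₓcₓ}`
is a `p`-th power in the layer field `K̄^H` (`b = β^p`).  Contrapositive = the non-vanishing test of the (B2′) road:
`b″ ∉ (K̄^H)^{×p}` ⇒ `cor(κ_H(β) ∪ e) ≠ 0`.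
Mechanism: `GaloisRepresentations.sum_conj_apply_eq_zero_of_coresLe_eq_zero` (the norm cocycle `Σₓ s(x)·ψ(s(x)⁻¹σs(x))`
vanishes identically on `H`) + `conj_pullback_kummerCupCocycle` (each conjugate is the Kummer–cup cocycle of `(s(x)β)^{bₓ}` with
point `s(x)e = cₓe`) + additivity of Kummer cocycles + injectivity of `t_{ζ,e}` (`N = p`, `e ≠ 0`).
Theorems only; no definition, no named fact.

## References
* K. Kato, Astérisque 295 (2004), (15.6.1) (p. 253), (15.12.1) (p. 263), 15.14 (p. 264). [Kato2004Asterisque]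
* J. Neukirch, A. Schmidt, K. Wingberg, *Cohomology of Number Fields* (2008), I §5 (1.5.6)–(1.5.7), I §6. [NeukirchSchmidtWingberg2008]
* J.-P. Serre, *Local Fields* (1979), VII §5; *Galois Cohomology* (1997), I §2, II §1.2. [SerreLocalFields1979] [SerreGaloisCohomology1997]
-/

noncomputable section

open scoped NumberField
open Field IsDedekindDomain
open Literature.NumberTheory.GaloisRepresentations
open Literature.NumberTheory.EllipticCurves
open WeierstrassCurve (geomPoints geomTorsion)

namespace Literature.NumberTheory.EllipticCurves.Kato2004

open DiscreteGaloisModule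

section Test

variable {K : Type} [Field K] (E : WeierstrassCurve K) (N : ℕ) [NeZero N]
  {H U : Subgroup (absoluteGaloisGroup K)} (ζ : (AlgebraicClosure K)ˣ) (hζ : IsPrimitiveRoot ζ N)
  {n : ℤ} (hn : (N : ℤ) = n) (e : geomTorsion E n)

omit [NeZero N] in
/-- The Kummer cocycle of a finite product is the sum of the Kummer cocycles (values).
[cite: SerreGaloisCohomology1997, II §1.2] -/
theorem muSubgroupKummerCocycle_prod_apply {ι : Type*} (S : Finset ι) (γ : ι → subgroupKummerUnits K N H) (σ : H) :
    (muSubgroupKummerCocycle K N H (∏ i ∈ S, γ i)).1 σ = ∑ i ∈ S, (muSubgroupKummerCocycle K N H (γ i)).1 σ := by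
  classical
  induction S using Finset.induction_on with
  | empty => rw [Finset.prod_empty, Finset.sum_empty, muSubgroupKummerCocycle_one]; rfl
  | insert i S hi ih =>
    rw [Finset.prod_insert hi, Finset.sum_insert hi, muSubgroupKummerCocycle_mul, Submodule.coe_add,
      ContinuousMap.add_apply, ih]

/-- Values of the Kummer–cup cocycle lie in `ker g` as soon as `g e = 0` (`t_{ζ,e}` takes values in `ℤ e`).
[cite: Kato2004Asterisque, (15.12.1) (p. 263)] -/
theorem map_kummerCupCocycle_apply_eq_zero (hHζ : ∀ σ : H, (σ : absoluteGaloisGroup K) • ζ = ζ)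
    (hHe : ∀ σ : H, (σ : absoluteGaloisGroup K) • e = e) (g : geomTorsion E n →+ geomTorsion E n) (hge : g e = 0)
    (β : subgroupKummerUnits K N H) (τ : H) :
    g ((contOneCocycles.pushAddHom (Y := subgroupRep (E.torsionGaloisModule n).toTopRep H)
        (muToTorsionHom E N ζ hζ hn e) continuous_of_discreteTopology
        (muToTorsionHom_subgroupRep E N H ζ hζ hn e hHζ hHe) (muSubgroupKummerCocycle K N H β)).1 τ) = 0 := by
  rw [contOneCocycles.pushAddHom_apply]
  obtain ⟨i, -, hi⟩ := MuCarrier.exists_eq_nsmul_of_isPrimitiveRoot hζ ((muSubgroupKummerCocycle K N H β).1 τ)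
  rw [hi, map_nsmul, muToTorsionHom_gen, map_nsmul, hge, smul_zero]

variable [H.Normal]

/-- ★ **The coboundary test.**  `H ⊴ Γ_K` open of finite index in `U ≥ H` with representatives `s`; `ζ` (primitive of prime
order `N = p`) and `e ∈ E[p]`, `e ≠ 0`, fixed by `H`; `g : E[p] → E[p]` additive, `U`-equivariant, `g e = 0`, `(im g)^U = 0`,
`H` trivial on `ker g`; `s(x)ζ = ζ^{aₓ}`, `bₓaₓ ≡ 1 (p)`, `s(x)e = cₓe`.  If `cor_{H→U}(κ_H(β) ∪_ζ e) = 0` in `H¹(U, E[p])`,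
then `β″ = ∏ₓ (s(x)β)^{bₓcₓ}` is fixed by every `σ ∈ H` (so `β″^p = ∏ₓ (s(x)β^p)^{bₓcₓ}` is a `p`-th power in `K̄^H`).
[cite: Kato2004Asterisque, (15.12.1) (p. 263) and 15.14 (p. 264)] [cite: NeukirchSchmidtWingberg2008, I §5 (1.5.6)–(1.5.7)]
[cite: SerreLocalFields1979, VII §5] -/
theorem forall_smul_eq_of_coresLe_kummerCupLevelClass_eq_zero (hle : H ≤ U)
    (hHo : IsOpen (H : Set (absoluteGaloisGroup K))) [Fintype (U ⧸ H.subgroupOf U)] {s : U ⧸ H.subgroupOf U → U}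
    (hs : ∀ x, (s x : U ⧸ H.subgroupOf U) = x)
    (hHζ : ∀ σ : H, (σ : absoluteGaloisGroup K) • ζ = ζ) (hHe : ∀ σ : H, (σ : absoluteGaloisGroup K) • e = e)
    (hp : N.Prime) (he : e ≠ 0) (g : geomTorsion E n →+ geomTorsion E n)
    (hgU : ∀ (u : U) (P : geomTorsion E n),
      g ((u : absoluteGaloisGroup K) • P) = (u : absoluteGaloisGroup K) • g P)
    (hge : g e = 0)
    (hinv : ∀ Q : geomTorsion E n, (∀ u : U, (u : absoluteGaloisGroup K) • g Q = g Q) → g Q = 0)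
    (hfix : ∀ P : geomTorsion E n, g P = 0 → ∀ σ : H, (σ : absoluteGaloisGroup K) • P = P)
    {a b c : U ⧸ H.subgroupOf U → ℕ} (ha : ∀ x, ((s x : U) : absoluteGaloisGroup K) • ζ = ζ ^ a x)
    (hb : ∀ x, b x * a x ≡ 1 [MOD N]) (hc : ∀ x, ((s x : U) : absoluteGaloisGroup K) • e = c x • e)
    (β : subgroupKummerUnits K N H)
    (h0 : coresLe (E.torsionGaloisModule n).toTopRep hle hHo (kummerCupLevelClass E N H ζ hζ hn e hHζ hHe β) = 0)
    (β'' : subgroupKummerUnits K N H)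
    (hβ'' : β'' = ∏ x, (⟨((s x : U) : absoluteGaloisGroup K) • (β : (AlgebraicClosure K)ˣ),
        smul_mem_subgroupKummerUnits_of_normal _ β.2⟩ : subgroupKummerUnits K N H) ^ (b x * c x))
    (σ : H) : (σ : absoluteGaloisGroup K) • (β'' : (AlgebraicClosure K)ˣ) = β'' := by
  subst hβ''
  -- the Kummer–cup cocycle `ψ = t_{ζ,e} ∘ κ_H(β)` and the generic vanishing test
  set ψ := contOneCocycles.pushAddHom (Y := subgroupRep (E.torsionGaloisModule n).toTopRep H)
    (muToTorsionHom E N ζ hζ hn e) continuous_of_discreteTopology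
    (muToTorsionHom_subgroupRep E N H ζ hζ hn e hHζ hHe) (muSubgroupKummerCocycle K N H β) with hψ
  have h0' : coresLe (E.torsionGaloisModule n).toTopRep hle hHo (oneCocycleClass _ ψ) = 0 := by
    rw [hψ, ← kummerCupLevelClass_eq_oneCocycleClass]; exact h0
  have key := sum_conj_apply_eq_zero_of_coresLe_eq_zero ((E.torsionGaloisModule n).toTopRep) hle hHo hs g
    (fun u P ↦ hgU u P) (fun Q hQ ↦ hinv Q hQ) (fun P hP τ ↦ hfix P hP τ) ψ
    (fun τ ↦ by rw [hψ]; exact map_kummerCupCocycle_apply_eq_zero E N ζ hζ hn e hHζ hHe g hge β τ) h0' σ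
  -- each conjugate summand is the Kummer–cup cocycle of `(s(x)β)^{bₓcₓ}` with the point `e`
  have hx : ∀ x, (E.torsionGaloisModule n).toTopRep.ρ ((s x : U) : absoluteGaloisGroup K)
      (ψ.1 (subgroupConj H ((s x : U) : absoluteGaloisGroup K) σ)) =
      muToTorsionHom E N ζ hζ hn e ((muSubgroupKummerCocycle K N H
        (⟨((s x : U) : absoluteGaloisGroup K) • (β : (AlgebraicClosure K)ˣ),
          smul_mem_subgroupKummerUnits_of_normal _ β.2⟩ ^ (b x * c x))).1 σ) := by
    intro x
    have h1 := congrArg (fun χ : contOneCocycles (subgroupRep (E.torsionGaloisModule n).toTopRep H) ↦ χ.1 σ)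
      (conj_pullback_kummerCupCocycle E N H ζ hζ hn e hHζ hHe ((s x : U) : absoluteGaloisGroup K) (ha x) (hb x) β)
    simp only at h1
    rw [conj_pullback_apply, contOneCocycles.pushAddHom_apply] at h1
    rw [hψ, contOneCocycles.pushAddHom_apply, h1, contOneCocycles.pushAddHom_apply, hc x, muToTorsionHom_nsmul_apply,
      ← map_nsmul, ← muSubgroupKummerCocycle_pow_apply, ← pow_mul]
  simp_rw [hx] at key
  rw [← map_sum, ← muSubgroupKummerCocycle_prod_apply, ← map_zero (muToTorsionHom E N ζ hζ hn e),
    (muToTorsionHom_injective_of_prime E N ζ hζ hn e hp he).eq_iff, ← (muVal_injective K N).eq_iff,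
    muVal_muSubgroupKummerCocycle_apply, muVal_zero, div_eq_one] at key
  exact key

end Test

end Literature.NumberTheory.EllipticCurves.Kato2004

end
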